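import Summits.ResolutionOfSingularities.ResolutionOfSingularities.Theorems.FrobeniusClosingPatchingRelPerfectDepthHSepComponentsExp
import Summits.ResolutionOfSingularities.ResolutionOfSingularities.Theorems.FrobeniusClosingPatchingRelPerfectDepthHSepPeel
import Summits.ResolutionOfSingularities.ResolutionOfSingularities.Theorems.FrobeniusClosingPatchingRelPerfectDepthGradedMemberBasics
import HarnessLib

/-!
# `PatchingRelPerfect` (stmt-ResolutionOfSingularities-16161), chain W5.2 — rung R5ᴴ N6: the E-side separation game `HSepGame₃`
# from CJS-B

[OURS · L1 W5.2 · res-D-pv-055, owner of R5ᴴ (plan-1 RULINGS G10-3, G11-4)] N6 **`hSepGame₃_of_cjsB :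
CossartJannsenSaito2020EmbeddedSequenceB → HSepGame₃`** — the E-side separation game on a regular excellent integral threefold
carrier `W` with one charged effective Cartier member `(D, ℓ)`: Cossart–Jannsen–Saito's embedded resolution with boundary (functor B),
transported into the `HSepSeq` currency with the END state presented as monomials over ONE snc family of components (N3/N4,
res-D-pv-054: `HSepCJS.components_of_cjsB_expFun`), then peeled to `HSepEnd` (N5, res-D-pv-016: `HSepPeel.exists_hSepEnd_of_monomialIdeal`).
Also `oneFormMemberIdeal_ne_bot` (discharges the binder `I ≠ ⊥` of `hLedMemberI_atomConclusion_of_targets`). The rung closer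
`hLedMember_atomConclusion_holds` (N1 + N6 + N2 fed into T-R5Hb) is the sibling file `…DepthHLedMemberHolds`.

Honest framing: OURS (AI-written, weaker than expert review); conditional on the typed statement of CJS 2020 Thm. 1.4 (functor B),
which the tree does not prove; nothing here is a statement of the manuscript under review.

## Sources
* V. Cossart, U. Jannsen, S. Saito, *Desingularization: invariants and strategy*, LNM 2270 (2020), Thm. 1.4. [CossartJannsenSaito2020]
* J. Kollár, *Lectures on Resolution of Singularities* (2007), (3.111) Step 3. [Kollar2007]
-/

set_option linter.dupNamespace false -- mandated namespace of this single-conjunct summit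

noncomputable section

open CategoryTheory CategoryTheory.Limits AlgebraicGeometry TopologicalSpace IsLocalRing
open Literature.AlgebraicGeometry.Resolution Scheme.IdealSheafData

namespace Summit.ResolutionOfSingularities.ResolutionOfSingularities.Theorems.DepthTargets

universe u

/-- **R5ᴴ N6 — the E-side separation game from CJS-B.** On an integral Noetherian regular excellent threefold `W`, for an effective
Cartier divisor `D` and a charge `ℓ ≥ 1`, there is an `HSepSeq ρ [(D, ℓ)] 𝒟'` reaching `HSepEnd 𝒟'`: CJS-B transported to components
(`HSepCJS.components_of_cjsB_expFun`), then the peel loop (`HSepPeel.exists_hSepEnd_of_monomialIdeal`).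
[cite: CossartJannsenSaito2020, Thm. 1.4] [cite: Kollar2007, (3.111) Step 3] -/
theorem hSepGame₃_of_cjsB (hCJS : CossartJannsenSaito2020EmbeddedSequenceB.{u}) : HSepGame₃.{u} := by
  intro W _ _ hreg hexc hdim D hD _ ℓ hℓ
  obtain ⟨W₁, ρ, _, _, 𝒟₁, 𝓔, hseq, -, h𝓔, hnd, hconn, -, hmono⟩ :=
    HSepCJS.components_of_cjsB_expFun hCJS W hreg hexc hdim D hD ℓ hℓ
  exact HSepPeel.exists_hSepEnd_of_monomialIdeal h𝓔 hnd hconn hmono hseq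

/-- One-form members are non-zero ideals: `x` spans the maximal ideal of a regular local ring of positive dimension, so some
`x_k ≠ 0` and `x_k^{d+ℓ} ≠ 0` lies in the member. [folklore] -/
theorem oneFormMemberIdeal_ne_bot {S : Type u} [CommRing S] [IsRegularLocalRing S] (hdim : ringKrullDim S = (3 + 1 : ℕ))
    {κ₀ : Type u} [Field κ₀] (σ : κ₀ →+* S) (x : Fin (3 + 1) → S) (hx : Ideal.span (Set.range x) = IsLocalRing.maximalIdeal S)
    (d ℓ : ℕ) (P₀ P₁ : Fin 1 → MvPolynomial (Fin (3 + 1)) κ₀) (G : Fin 1 → S) :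
    oneFormMemberIdeal σ x d ℓ P₀ P₁ G ≠ ⊥ := by
  haveI : IsDomain S := isDomain_of_isRegularLocalRing S
  have hne : ∃ k, x k ≠ 0 := by
    by_contra h
    apply maximalIdeal_ne_bot_of_ringKrullDim_eq_succ hdim
    rw [← hx, Ideal.span_eq_bot]
    rintro _ ⟨k, rfl⟩
    exact not_not.mp fun hk => h ⟨k, hk⟩
  obtain ⟨k, hk⟩ := hne
  intro hI
  have hmem : x k ^ (d + ℓ) ∈ oneFormMemberIdeal σ x d ℓ P₀ P₁ G :=
    Ideal.mem_sup_right (Ideal.subset_span ⟨k, rfl⟩)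
  rw [hI, Ideal.mem_bot] at hmem
  exact pow_ne_zero _ hk hmem

end Summit.ResolutionOfSingularities.ResolutionOfSingularities.Theorems.DepthTargets

end
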